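import Summits.BirchSwinnertonDyer.Rank1Residual.P2.CongruentNumberThetaStarSilentBlocks
import HarnessLib
import HarnessLib.Audit.Tags

/-!
# Cell «bsd-monsky» (prover-B): 𝒮⁻-TOWERS — Tian–Yuan–Zhang's Theorem 1.2 is SILENT on the one-mark towers: the printed second genus
# sum `Σ₂′(2·q·p₁⋯p_m)` is EVEN, for EVERY `m` (kernel theorem modulo Rédei–Reichardt, a tree theorem; nothing asserted, nothing booked)

HONEST FRAMING (cell `bsd-monsky`, run/shared/lean/pub/bsd-monsky/; README §1/§3): «ℓ ≥ 3 rungs are NOT claimed — record what the same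
argument gives there, no more». `P2/CongruentNumberThetaStar{Family,BSD,Towers,TowersBSD}.lean` prove Monsky's (a)+(b) shape on the
𝒮⁻-towers `n = 2·q·p₁⋯p_m` (`q ≡ 3 (mod 4)`; `pᵢ ≡ 5 (mod 8)` pairwise quadratic residues; EXACTLY one `p_a` a non-residue mod `q`) for every
`m`. The only printed criterion for `n ≡ 6 (mod 8)` is Tian–Yuan–Zhang 2017, Thm. 1.2: «`2^{−ρ}𝓛(n)` even ⟹ `Σ₂′(n)` even», which yields
`ord_{s=1} L(E_n, s) = 1` exactly when the PRINTED second genus sum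
`Σ₂′(n) = Σ_{n = d₀d₁⋯d_ℓ non-ordered, d₀ ≡ 5,6,7, d₁ ≡ 1,2,3, dᵢ ≡ 1 (8)} ∏ g(dᵢ)` (`genusSum₂'`, the `ℓ = 0` term included) is ODD. THIS FILE
proves that on the one-mark towers `Σ₂′(n)` is EVEN for every `m` — TYZ's theorem is SILENT there, so the tower theorems are not instances
of it (nor of Tian 2014 Thm. 1.3 / 5.2, whose extra primes are `≡ 1 (mod 8)`, nor of TYZ Cor. 1.4, which has no `n ≡ 6` clause).
PROOF (§2, `decomp_tower_shape`): by the `g`-parity table of `…ThetaStarSilentBlocks` / `…ThetaStarFamily` (pure blocks `z ∣ P`, `z ≡ 1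
(mod 8)`, `z > 1`: `g` even; `2z`: `g` odd; `qz`: `g` odd iff every prime of `z` is marked; `n`: `g` odd), a decomposition counted in
`Σ₂′(n)` all of whose parts have odd `g` is either `{n}` or `{2P/w, qw}` with `w ∈ {1, p_a}` and `qw ≡ 7 (mod 8)` — i.e. `w = p_a` if `q ≡ 3`
and `w = 1` if `q ≡ 7 (mod 8)`: the part containing `2` is `2z` or `2qz`; `2qz ≡ 6` must be `d₀` and tolerates no other part; `2z ≡ 2`
uses up the one allowed part `≢ 1`, forcing the `q`-part to be `d₀ ≡ 7` and every further part to be a pure block `≡ 1` of even `g`.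
Hence `Σ₂′(n) ≡ g(n) + g(2P/w)g(qw) ≡ 1 + 1 ≡ 0` (§3, `even_genusSum₂'_tower`). CONTROL (never an input): kit j252342 / j253031 — `Σ₂′ = 0`
on every one-mark member tested (`m ≤ 5`), `= 1` on every mark-free one. Modulo Rédei–Reichardt only (`redeiReichardt_fourTwoCard_classGroup_holds`,
a tree theorem); no `decide` on patterns; no definition; nothing asserted; no count moves; NOT refereed, not part of PROOF-B v1.3 / the paper.

References: [TianYuanZhang2017] Thm. 1.2 (p0002 L115–L127), proof of Prop. 3.4 (p0016 L146: the ℓ = 0 term), Cor. 1.4; [Tian2014] Thm. 1.3,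
Thm. 5.2; [LiMa2008] Thm. 0.4; [HardyWright2008] §1.3 Thm. 2, §17.8; HOME/proof/PROOF-B-THETA-STAR.md §3/§7.
-/

noncomputable section

open scoped Classical

open Matrix Finset Literature.NumberTheory.EllipticCurves.TianYuanZhang2017
  Literature.NumberTheory.EllipticCurves.TianYuanZhang2017.W2
  Literature.NumberTheory.EllipticCurves.HeathBrown1994
  Literature.NumberTheory.QuadraticFields.RedeiReichardt

set_option autoImplicit false

namespace Summit.BirchSwinnertonDyer.Rank1Residual.P2

namespace ThetaDescent

variable {m : ℕ} {q : ℕ} {p : Fin m → ℕ}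

/-! ## §1 Divisors of `n = 2·q·P` -/

/-- Every divisor of `n = 2·q·P` is `z`, `qz`, `2z` or `2qz` with `z ∣ P`. [cite: HardyWright2008, §1.3 Thm. 2] -/
theorem dvd_star_shape (hq : q.Prime) {d : ℕ} (hd : d ∣ 2 * (q * ∏ i, p i)) :
    ∃ z, z ∣ ∏ i, p i ∧ (d = z ∨ d = q * z ∨ d = 2 * z ∨ d = 2 * (q * z)) := by
  obtain ⟨y, w, hy, hw, rfl⟩ := Nat.dvd_mul.mp hd
  obtain ⟨y', z, hy', hz, rfl⟩ := Nat.dvd_mul.mp hw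
  refine ⟨z, hz, ?_⟩
  rcases (Nat.dvd_prime Nat.prime_two).mp hy with rfl | rfl <;>
    rcases (Nat.dvd_prime hq).mp hy' with rfl | rfl
  · exact Or.inl (by ring)
  · exact Or.inr (Or.inl (by ring))
  · exact Or.inr (Or.inr (Or.inl (by ring)))
  · exact Or.inr (Or.inr (Or.inr rfl))

/-- `q ∤ P` (`q ≡ 3 (mod 4)` is none of the `pᵢ ≡ 5 (mod 8)`). [cite: HardyWright2008, §1.3 Thm. 2] -/
theorem not_q_dvd_prod_five (hq : q.Prime) (hq4 : q % 4 = 3) (hp : ∀ i, (p i).Prime) (hp5 : ∀ i, p i % 8 = 5) :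
    ¬ q ∣ ∏ i, p i := fun h => by
  obtain ⟨i, -, hi⟩ := ((Nat.Prime.prime hq).dvd_finsetProd_iff p).mp h
  have := (Nat.prime_dvd_prime_iff_eq hq (hp i)).mp hi
  have := hp5 i
  omega

/-- A divisor of `P` all of whose prime factors are `p_a` is `1` or `p_a` (`P` square-free). [cite: HardyWright2008, §17.8] -/
theorem eq_one_or_eq_of_dvd_prod_five (hp : ∀ i, (p i).Prime) (hinj : Function.Injective p) {z : ℕ} (hz : z ∣ ∏ i, p i)
    {a : Fin m} (hall : ∀ i, p i ∣ z → i = a) : z = 1 ∨ z = p a := by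
  have hzsq : Squarefree z := (squarefree_prod_of_injective p hp hinj).squarefree_of_dvd hz
  have hsub : z.primeFactors ⊆ {p a} := by
    intro r hr
    have hrp : r.Prime := Nat.prime_of_mem_primeFactors hr
    obtain ⟨i, -, hi⟩ := ((Nat.Prime.prime hrp).dvd_finsetProd_iff p).mp ((Nat.dvd_of_mem_primeFactors hr).trans hz)
    have hri : r = p i := (Nat.prime_dvd_prime_iff_eq hrp (hp i)).mp hi
    rw [Finset.mem_singleton, hri, hall i (hri ▸ Nat.dvd_of_mem_primeFactors hr)]
  rcases Finset.subset_singleton_iff.mp hsub with h | h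
  · left; rw [← Nat.prod_primeFactors_of_squarefree hzsq, h, Finset.prod_empty]
  · right; rw [← Nat.prod_primeFactors_of_squarefree hzsq, h, Finset.prod_singleton]

/-! ## §2 The decompositions counted in `Σ₂′(n)` with all parts of odd `g` -/

/-- **Classification.** On the one-mark tower type (`q ≡ 3 (mod 4)`, exactly one mark `a`), a decomposition `D` of `n = 2·q·P` counted in
TYZ's `Σ₂′(n)` (some `d₀ ∈ D` is `≡ 5, 6, 7`, every other part is `≡ 1, 2, 3`, at most one of them `≢ 1 (mod 8)`) all of whose parts have
ODD `g` is `{n}` or `{2P/w, q·w}` with `w ∈ {1, p_a}` and `q·w ≡ 7 (mod 8)`. [cite: TianYuanZhang2017, Thm. 1.2 (p0002 L115–L127)] [cite: LiMa2008, Thm. 0.4] -/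
theorem decomp_tower_shape (hq : q.Prime) (hq4 : q % 4 = 3) (hp : ∀ i, (p i).Prime) (hp5 : ∀ i, p i % 8 = 5)
    (hinj : Function.Injective p) (hQR : ∀ i j, i ≠ j → kroneckerBit (p j) (p i) = 0)
    {a : Fin m} (ha1 : ∀ i, kroneckerBit (p i) q = 1 → i = a) {D : Finset ℕ}
    (hD : D ∈ decompositions (2 * (q * ∏ i, p i)))
    (hfil : ∃ d₀ ∈ D, (d₀ % 8 = 5 ∨ d₀ % 8 = 6 ∨ d₀ % 8 = 7) ∧ (∀ d ∈ D, d ≠ d₀ → (d % 8 = 1 ∨ d % 8 = 2 ∨ d % 8 = 3)) ∧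
      ((D.erase d₀).filter fun d => d % 8 ≠ 1).card ≤ 1)
    (hodd : ∀ d ∈ D, Odd (gK d)) :
    D = {2 * (q * ∏ i, p i)} ∨
      ∃ w, (w = 1 ∨ w = p a) ∧ (q * w) % 8 = 7 ∧ D = {2 * ((∏ i, p i) / w), q * w} := by
  have hsqn := squarefree_star' hq hq4 hp hp5 hinj
  obtain ⟨hsub, h1, hcop, hprod⟩ := mem_decompositions_iff.mp hD
  obtain ⟨d₀, hd₀, h567, hothers, hcard⟩ := hfil
  have hdvd : ∀ d ∈ D, d ∣ 2 * (q * ∏ i, p i) := fun d hd => Nat.dvd_of_mem_divisors (hsub hd)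
  have hqP := not_q_dvd_prod_five hq hq4 hp hp5
  have hPodd : ∀ z, z ∣ ∏ i, p i → z % 2 = 1 := fun z hz => by
    rcases mod_eight_of_dvd_prod_five hp hp5 hinj hz with h | h <;> omega
  -- coprime parts share no prime
  have hncop : ∀ {d d' r : ℕ}, d ∈ D → d' ∈ D → d ≠ d' → r.Prime → r ∣ d → r ∣ d' → False := by
    intro d d' r hd hd' hne hr hrd hrd'
    have hc : Nat.Coprime d d' := hcop (Finset.mem_coe.mpr hd) (Finset.mem_coe.mpr hd') hne
    have h1r : r ∣ 1 := by rw [← Nat.Coprime.gcd_eq_one hc]; exact Nat.dvd_gcd hrd hrd'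
    exact hr.one_lt.ne' (Nat.dvd_one.mp h1r)
  -- a part other than `d₀` is never a pure block
  have hqz8 : ∀ z, z ∣ ∏ i, p i → (q * z) % 8 = 3 ∨ (q * z) % 8 = 7 := fun z hz => by
    have hq' : q % 8 = 3 ∨ q % 8 = 7 := by omega
    rcases mod_eight_of_dvd_prod_five hp hp5 hinj hz with h | h <;> rcases hq' with h' | h' <;>
      rw [Nat.mul_mod, h', h] <;> decide
  have hpure : ∀ d ∈ D, d ≠ d₀ → ∀ z, z ∣ ∏ i, p i → d = z → False := by
    intro d hd hne z hz hdz
    rw [← hdz] at hz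
    have h15 := mod_eight_of_dvd_prod_five hp hp5 hinj hz
    have h123 := hothers d hd hne
    have hz1 : d % 8 = 1 := by omega
    have heven := even_genusClassNumber_of_dvd_prod_five hp hp5 hinj hQR hz (h1 d hd) hz1
    exact (Nat.not_even_iff_odd.mpr (hodd d hd)) heven
  -- a part coprime to `2` and to `q` is pure
  have hshape_pure : ∀ d ∈ D, ¬ 2 ∣ d → ¬ q ∣ d → ∃ z, z ∣ ∏ i, p i ∧ d = z := by
    intro d hd h2 hqd
    obtain ⟨z, hz, h | h | h | h⟩ := dvd_star_shape hq (hdvd d hd)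
    · exact ⟨z, hz, h⟩
    · exact absurd (h ▸ dvd_mul_right q z) hqd
    · exact absurd (h ▸ dvd_mul_right 2 z) h2
    · exact absurd (h ▸ (dvd_mul_right q z).trans (dvd_mul_left _ 2)) hqd
  -- the part containing `2`
  obtain ⟨d₂, hd₂, h2d₂⟩ : ∃ d ∈ D, 2 ∣ d :=
    (Nat.prime_two.prime.dvd_finsetProd_iff (fun d => d)).mp (by rw [hprod]; exact dvd_mul_right 2 _)
  -- the part containing `q`
  obtain ⟨dq, hdq, hqdq⟩ : ∃ d ∈ D, q ∣ d :=
    ((Nat.Prime.prime hq).dvd_finsetProd_iff (fun d => d)).mp (by rw [hprod]; exact ⟨2 * ∏ i, p i, by ring⟩)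
  obtain ⟨z₀, hz₀, hs₀ | hs₀ | hs₀ | hs₀⟩ := dvd_star_shape hq (hdvd d₀ hd₀)
  · -- `d₀` pure (`≡ 5`): the parts containing `2` (`≡ 2`) and `q` (`≡ 3`) are two further parts `≢ 1`
    exfalso
    have hd₀odd : d₀ % 2 = 1 := hs₀ ▸ hPodd z₀ hz₀
    have h2ne : d₂ ≠ d₀ := fun h => by rw [h] at h2d₂; omega
    have hqne : dq ≠ d₀ := by
      intro h
      rw [h, hs₀] at hqdq
      exact hqP (hqdq.trans hz₀)
    have hd₂2 : d₂ % 8 = 2 := by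
      have := hothers d₂ hd₂ h2ne; omega
    have h2q : d₂ ≠ dq := by
      intro h
      have hqd₂ : q ∣ d₂ := h ▸ hqdq
      obtain ⟨z, hz, h' | h' | h' | h'⟩ := dvd_star_shape hq (hdvd d₂ hd₂)
      · have := hPodd z hz; rw [h'] at h2d₂; omega
      · have := hqz8 z hz; rw [h'] at hd₂2; omega
      · rw [h'] at hqd₂
        exact hqP ((((Nat.coprime_primes hq Nat.prime_two).mpr (by omega)).dvd_of_dvd_mul_left hqd₂).trans hz)
      · have := hqz8 z hz; rw [h'] at hd₂2; omega
    have hdqodd : ¬ 2 ∣ dq := fun h2 => hncop hd₂ hdq h2q Nat.prime_two h2d₂ h2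
    have hdq3 : dq % 8 = 3 := by
      obtain ⟨z, hz, h' | h' | h' | h'⟩ := dvd_star_shape hq (hdvd dq hdq)
      · exact absurd (h' ▸ hqdq) (fun h => hqP (h.trans hz))
      · have h37 := hqz8 z hz
        rw [← h'] at h37
        have := hothers dq hdq hqne
        omega
      · exact absurd (h' ▸ dvd_mul_right 2 z) hdqodd
      · exact absurd (h' ▸ dvd_mul_right 2 (q * z)) hdqodd
    have hboth : d₂ ∈ (D.erase d₀).filter (fun d => d % 8 ≠ 1) ∧ dq ∈ (D.erase d₀).filter (fun d => d % 8 ≠ 1) :=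
      ⟨Finset.mem_filter.mpr ⟨Finset.mem_erase.mpr ⟨h2ne, hd₂⟩, by omega⟩,
        Finset.mem_filter.mpr ⟨Finset.mem_erase.mpr ⟨hqne, hdq⟩, by omega⟩⟩
    exact h2q (Finset.card_le_one.mp hcard _ hboth.1 _ hboth.2)
  · -- `d₀ = q z₀ ≡ 7`: the `2`-part is `2 z₂`, there is no other part
    have hd₀odd : ¬ 2 ∣ d₀ := by
      intro h2
      have := hqz8 z₀ hz₀
      rw [← hs₀] at this
      omega
    have h2ne : d₂ ≠ d₀ := fun h => hd₀odd (h ▸ h2d₂)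
    have hqd₂ : ¬ q ∣ d₂ := fun h => hncop hd₀ hd₂ h2ne.symm hq (hs₀ ▸ dvd_mul_right q z₀) h
    obtain ⟨z₂, hz₂, hd₂eq⟩ : ∃ z₂, z₂ ∣ ∏ i, p i ∧ d₂ = 2 * z₂ := by
      obtain ⟨z, hz, h' | h' | h' | h'⟩ := dvd_star_shape hq (hdvd d₂ hd₂)
      · have := hPodd z hz; rw [h'] at h2d₂; omega
      · exact absurd (h' ▸ dvd_mul_right q z) hqd₂
      · exact ⟨z, hz, h'⟩
      · exact absurd (h' ▸ (dvd_mul_right q z).trans (dvd_mul_left _ 2)) hqd₂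
    -- no third part
    have hD : D = {d₀, d₂} := by
      refine Finset.Subset.antisymm (fun d hd => ?_) (by simp [Finset.insert_subset_iff, hd₀, hd₂])
      rw [Finset.mem_insert, Finset.mem_singleton]
      by_contra hne
      push Not at hne
      have h2d : ¬ 2 ∣ d := fun h => hncop hd₂ hd hne.2.symm Nat.prime_two h2d₂ h
      have hqd : ¬ q ∣ d := fun h => hncop hd₀ hd hne.1.symm hq (hs₀ ▸ dvd_mul_right q z₀) h
      obtain ⟨z, hz, hdz⟩ := hshape_pure d hd h2d hqd
      exact hpure d hd hne.1 z hz hdz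
    -- `z₀ z₂ = P`
    have hzP : z₀ * z₂ = ∏ i, p i := by
      have h := hprod
      rw [hD, Finset.prod_pair h2ne.symm, hs₀, hd₂eq] at h
      have h' : 2 * q * (z₀ * z₂) = 2 * q * ∏ i, p i := by
        rw [show 2 * q * ∏ i, p i = 2 * (q * ∏ i, p i) by ring, ← h]; ring
      exact Nat.eq_of_mul_eq_mul_left (by have := hq.pos; omega) h'
    -- every prime of `z₀` is marked, so `z₀ ∈ {1, p_a}`
    have hz₀w : z₀ = 1 ∨ z₀ = p a := by
      refine eq_one_or_eq_of_dvd_prod_five hp hinj hz₀ fun i hi => ha1 i ?_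
      rcases (by decide : ∀ c : ZMod 2, c = 0 ∨ c = 1) (kroneckerBit (p i) q) with h0 | h1'
      · exact absurd (even_gK_q_mul_of_unmarked hq hq4 hp hp5 hinj hQR hz₀ hi h0)
          (Nat.not_even_iff_odd.mpr (hs₀ ▸ hodd d₀ hd₀))
      · exact h1'
    refine Or.inr ⟨z₀, hz₀w, ?_, ?_⟩
    · have h37 := hqz8 z₀ hz₀
      rw [← hs₀] at h37 ⊢
      omega
    · have hz₀pos : 0 < z₀ := Nat.pos_of_ne_zero fun h => by rw [h] at hzP; simp at hzP; exact hsqn.ne_zero (by rw [← hzP]; ring)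
      have hdiv : (∏ i, p i) / z₀ = z₂ := by rw [← hzP, Nat.mul_div_cancel_left _ hz₀pos]
      rw [hD, hdiv, ← hs₀, ← hd₂eq, Finset.pair_comm]
  · -- `d₀ = 2 z₀ ≡ 2`: not a `d₀`
    exfalso
    have := mod_eight_of_dvd_prod_five hp hp5 hinj hz₀
    omega
  · -- `d₀ = 2 q z₀ ≡ 6`: no other part, `D = {n}`
    left
    have hD : D = {d₀} := by
      refine Finset.eq_singleton_iff_unique_mem.mpr ⟨hd₀, fun d hd => ?_⟩
      by_contra hne
      have h2d : ¬ 2 ∣ d := fun h => hncop hd₀ hd (Ne.symm hne) Nat.prime_two (hs₀ ▸ dvd_mul_right 2 _) h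
      have hqd : ¬ q ∣ d := fun h => hncop hd₀ hd (Ne.symm hne) hq (hs₀ ▸ (dvd_mul_right q z₀).trans (dvd_mul_left _ 2)) h
      obtain ⟨z, hz, hdz⟩ := hshape_pure d hd h2d hqd
      exact hpure d hd hne z hz hdz
    rw [hD, Finset.prod_singleton] at hprod
    rw [hD, hprod]

/-! ## §3 `Σ₂′(n)` is EVEN on the one-mark towers, for every `m` -/

/-- **Tian–Yuan–Zhang's Theorem 1.2 is SILENT on the 𝒮⁻-towers with one mark, for every number of prime factors.** For distinct primes
`q ≡ 3 (mod 4)`, `p₁, …, p_m ≡ 5 (mod 8)` with `(pⱼ/pᵢ) = +1` (`i ≠ j`) and EXACTLY one `p_a` with `(p_a/q) = −1`, the PRINTED second genus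
sum of `n = 2·q·p₁⋯p_m` is EVEN: `Σ₂′(n) ≡ g(n) + g(2P/w)·g(qw) ≡ 1 + 1 (mod 2)` (`w = p_a` for `q ≡ 3`, `w = 1` for `q ≡ 7 (mod 8)`; every
other counted decomposition has a part of even `g`, §2). So the criterion `2^{−ρ}𝓛(n) even ⟹ Σ₂′ even` says nothing about these `n`,
whatever `ρ`. Modulo Rédei–Reichardt (a tree theorem) only; nothing asserted; NOT refereed.
[cite: TianYuanZhang2017, Thm. 1.2 (p0002 L115–L127); proof of Prop. 3.4 (p0016 L146)] [cite: LiMa2008, Thm. 0.4] -/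
theorem even_genusSum₂'_tower (hq : q.Prime) (hq4 : q % 4 = 3) (hp : ∀ i, (p i).Prime) (hp5 : ∀ i, p i % 8 = 5)
    (hinj : Function.Injective p) (hQR : ∀ i j, i ≠ j → kroneckerBit (p j) (p i) = 0)
    {a : Fin m} (ha : kroneckerBit (p a) q = 1) (ha1 : ∀ i, kroneckerBit (p i) q = 1 → i = a) :
    Even (genusSum₂' (2 * (q * ∏ i, p i)) fun d => genusClassNumber (GenusField d)) := by
  have hsqn := squarefree_star' hq hq4 hp hp5 hinj
  have hn6 := star_mod_eight' hq4 hp hp5 hinj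
  have hqP := not_q_dvd_prod_five hq hq4 hp hp5
  have hPpos : 0 < ∏ i, p i := Finset.prod_pos fun i _ => (hp i).pos
  have hμ : ∀ i j, kroneckerBit (p i) q = 1 → kroneckerBit (p j) q = 1 → i = j := fun i j hi hj => (ha1 i hi).trans (ha1 j hj).symm
  -- the second surviving decomposition
  set w₀ : ℕ := if q % 8 = 3 then p a else 1 with hw₀def
  have hw₀ : (w₀ = 1 ∨ w₀ = p a) ∧ (q * w₀) % 8 = 7 ∧ w₀ ∣ ∏ i, p i := by
    by_cases h3 : q % 8 = 3
    · rw [hw₀def, if_pos h3]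
      exact ⟨Or.inr rfl, by rw [Nat.mul_mod, h3, hp5 a], Finset.dvd_prod_of_mem p (mem_univ a)⟩
    · rw [hw₀def, if_neg h3]
      exact ⟨Or.inl rfl, by omega, one_dvd _⟩
  obtain ⟨hw₀1, hw₀7, hw₀P⟩ := hw₀
  have hw₀pos : 0 < w₀ := Nat.pos_of_dvd_of_pos hw₀P hPpos
  have hPw : (∏ i, p i) / w₀ * w₀ = ∏ i, p i := Nat.div_mul_cancel hw₀P
  have hPw' : (∏ i, p i) / w₀ ∣ ∏ i, p i := Nat.div_dvd_of_dvd hw₀P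
  -- `g`-parities of the surviving parts
  have hgn : Odd (gK (2 * (q * ∏ i, p i))) := odd_gK_tower hq hq4 hp hp5 hinj hQR hμ (Or.inr ⟨a, ha⟩)
  have hg2 : Odd (gK (2 * ((∏ i, p i) / w₀))) := odd_gK_two_mul_of_dvd_prod_five hp hp5 hinj hQR hPw'
  have hgq : Odd (gK (q * w₀)) := by
    rcases hw₀1 with h | h
    · rw [h, mul_one]; exact odd_genusClassNumber_genusField_prime redeiReichardt_fourTwoCard_classGroup_holds hq hq4
    · rw [h]; exact odd_gK_q_mul_marked hq hq4 hp hp5 ha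
  -- residues and sizes of the surviving parts
  have h2P : (2 * ((∏ i, p i) / w₀)) % 8 = 2 := by
    rcases mod_eight_of_dvd_prod_five hp hp5 hinj hPw' with h | h <;> omega
  have hqw_ne : 2 * ((∏ i, p i) / w₀) ≠ q * w₀ := fun h => by
    have h1 := h2P; rw [h] at h1; omega
  have hn_ne : 2 * (q * ∏ i, p i) ≠ q * w₀ := fun h => by
    have h1 := hn6; rw [h] at h1; omega
  set D₁ : Finset ℕ := {2 * (q * ∏ i, p i)} with hD₁
  set D₂ : Finset ℕ := {2 * ((∏ i, p i) / w₀), q * w₀} with hD₂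
  have hD₁₂ : D₁ ≠ D₂ := by
    intro h
    have : q * w₀ ∈ D₁ := by rw [h, hD₂]; simp
    rw [hD₁, Finset.mem_singleton] at this
    exact hn_ne this.symm
  -- both survive the filter
  set F := (decompositions (2 * (q * ∏ i, p i))).filter (fun D => ∃ d₀ ∈ D, (d₀ % 8 = 5 ∨ d₀ % 8 = 6 ∨ d₀ % 8 = 7) ∧
      (∀ d ∈ D, d ≠ d₀ → (d % 8 = 1 ∨ d % 8 = 2 ∨ d % 8 = 3)) ∧
      ((D.erase d₀).filter fun d => d % 8 ≠ 1).card ≤ 1) with hF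
  have hD₁F : D₁ ∈ F := by
    refine Finset.mem_filter.mpr ⟨singleton_mem_decompositions (by omega), 2 * (q * ∏ i, p i), Finset.mem_singleton_self _,
      Or.inr (Or.inl hn6), fun d hd hne => absurd (Finset.mem_singleton.mp hd) hne, ?_⟩
    rw [hD₁, Finset.erase_singleton, Finset.filter_empty, Finset.card_empty]; omega
  have hcop2 : Nat.Coprime (2 * ((∏ i, p i) / w₀)) (q * w₀) := by
    refine Nat.Coprime.mul_left ?_ (Nat.Coprime.mul_right ?_ ?_)
    · exact (Nat.coprime_primes Nat.prime_two hq |>.mpr (by omega)).mul_right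
        (Nat.coprime_two_left.mpr (Nat.odd_iff.mpr (by
          rcases hw₀1 with h | h <;> [simp [h]; (rw [h]; have := hp5 a; omega)])))
    · exact Nat.Coprime.symm ((Nat.Prime.coprime_iff_not_dvd hq).mpr fun h => hqP (h.trans hPw'))
    · rcases hw₀1 with h | h
      · rw [h]; exact Nat.coprime_one_right _
      · rw [h]
        refine Nat.Coprime.symm ((Nat.Prime.coprime_iff_not_dvd (hp a)).mpr fun hd => ?_)
        have hsq := squarefree_prod_of_injective p hp hinj
        have hmul : p a * p a ∣ ∏ i, p i := by
          have h2 := Nat.mul_dvd_mul_left (p a) hd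
          rwa [show p a * ((∏ i, p i) / p a) = ∏ i, p i from by rw [mul_comm]; exact h ▸ hPw] at h2
        exact (hp a).not_isUnit (hsq (p a) hmul)
  have hD₂F : D₂ ∈ F := by
    refine Finset.mem_filter.mpr ⟨?_, q * w₀, by simp [hD₂], Or.inr (Or.inr hw₀7), fun d hd hne => ?_, ?_⟩
    · rw [mem_decompositions_iff]
      refine ⟨fun d hd => ?_, fun d hd => ?_, ?_, ?_⟩
      · rw [hD₂, Finset.mem_insert, Finset.mem_singleton] at hd
        rcases hd with rfl | rfl
        · exact Nat.mem_divisors.mpr ⟨⟨q * w₀, by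
            rw [show 2 * ((∏ i, p i) / w₀) * (q * w₀) = 2 * (q * ((∏ i, p i) / w₀ * w₀)) by ring, hPw]⟩, hsqn.ne_zero⟩
        · exact Nat.mem_divisors.mpr ⟨⟨2 * ((∏ i, p i) / w₀), by
            rw [show q * w₀ * (2 * ((∏ i, p i) / w₀)) = 2 * (q * ((∏ i, p i) / w₀ * w₀)) by ring, hPw]⟩, hsqn.ne_zero⟩
      · rw [hD₂, Finset.mem_insert, Finset.mem_singleton] at hd
        rcases hd with rfl | rfl
        · have := Nat.pos_of_dvd_of_pos hPw' hPpos; omega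
        · exact lt_of_lt_of_le hq.one_lt (Nat.le_mul_of_pos_right _ hw₀pos)
      · rw [hD₂, Finset.coe_insert, Finset.coe_singleton]
        refine Set.pairwise_insert.mpr ⟨Set.pairwise_singleton _ _, fun b hb _ => ?_⟩
        rw [Set.mem_singleton_iff] at hb
        subst hb
        exact ⟨hcop2, hcop2.symm⟩
      · rw [hD₂, Finset.prod_pair hqw_ne, show 2 * ((∏ i, p i) / w₀) * (q * w₀) =
          2 * (q * ((∏ i, p i) / w₀ * w₀)) by ring, hPw]
    · rw [hD₂, Finset.mem_insert, Finset.mem_singleton] at hd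
      rcases hd with rfl | rfl
      · omega
      · exact absurd rfl hne
    · calc ((D₂.erase (q * w₀)).filter fun d => d % 8 ≠ 1).card ≤ (D₂.erase (q * w₀)).card := Finset.card_filter_le _ _
        _ ≤ 1 := by
          rw [hD₂, Finset.pair_comm, Finset.erase_insert (by simpa using hqw_ne.symm), Finset.card_singleton]
  -- assemble
  refine ZMod.natCast_eq_zero_iff_even.mp ?_
  unfold genusSum₂'
  rw [← hF, Nat.cast_sum, ← Finset.add_sum_erase _ _ hD₁F,
    ← Finset.add_sum_erase _ _ (Finset.mem_erase.mpr ⟨hD₁₂.symm, hD₂F⟩)]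
  have ht₁ : ((∏ d ∈ D₁, genusClassNumber (GenusField d) : ℕ) : ZMod 2) = 1 := by
    rw [hD₁, Finset.prod_singleton]; exact ZMod.natCast_eq_one_iff_odd.mpr hgn
  have ht₂ : ((∏ d ∈ D₂, genusClassNumber (GenusField d) : ℕ) : ZMod 2) = 1 := by
    rw [hD₂, Finset.prod_pair hqw_ne]; exact ZMod.natCast_eq_one_iff_odd.mpr (hg2.mul hgq)
  have hrest : ∑ D ∈ (F.erase D₁).erase D₂, ((∏ d ∈ D, genusClassNumber (GenusField d) : ℕ) : ZMod 2) = 0 := by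
    refine Finset.sum_eq_zero fun D hD => ?_
    obtain ⟨hD2, hD'⟩ := Finset.mem_erase.mp hD
    obtain ⟨hD1, hDF⟩ := Finset.mem_erase.mp hD'
    obtain ⟨hDdec, hDfil⟩ := Finset.mem_filter.mp hDF
    by_cases hall : ∀ d ∈ D, Odd (gK d)
    · exfalso
      rcases decomp_tower_shape hq hq4 hp hp5 hinj hQR ha1 hDdec hDfil hall with h | ⟨w, hw, hw7, h⟩
      · exact hD1 (h.trans hD₁.symm)
      · -- `w = w₀`
        have hww : w = w₀ := by
          rcases hw with rfl | rfl <;> rcases hw₀1 with h' | h'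
          · exact h'.symm
          · exfalso
            rw [h'] at hw₀7
            rw [mul_one] at hw7
            have : (q * p a) % 8 = 3 := by rw [Nat.mul_mod, hw7, hp5 a]
            omega
          · exfalso
            rw [h', mul_one] at hw₀7
            have : (q * p a) % 8 = 3 := by rw [Nat.mul_mod, hw₀7, hp5 a]
            omega
          · exact h'.symm
        rw [hww] at h
        exact hD2 (h.trans hD₂.symm)
    · push Not at hall
      obtain ⟨d, hd, hdeven⟩ := hall
      rw [ZMod.natCast_eq_zero_iff_even]
      exact even_iff_two_dvd.mpr ((even_iff_two_dvd.mp (Nat.not_odd_iff_even.mp hdeven)).trans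
        (Finset.dvd_prod_of_mem _ hd))
  rw [ht₁, ht₂, hrest]
  decide

end ThetaDescent

end Summit.BirchSwinnertonDyer.Rank1Residual.P2

end
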